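import Literature.Computability.AlgebraicComplexity.IK2020ContentSubspaceProofs
import Literature.Computability.AlgebraicComplexity.IK2020BlockWordStabilizer
import Literature.NumberTheory.DiophantineGeometry.SchurWeylHighestWeightProofs
import Literature.NumberTheory.DiophantineGeometry.SymmetricGroupRepsYoungSymmetrizerMulSelfProofs
import Literature.NumberTheory.DiophantineGeometry.SymmetricGroupRepsSignTwist
import Literature.NumberTheory.DiophantineGeometry.GLHighestWeightFacts
import HarnessLib

/-!
# Ikenmeyer–Kandasamy 2020, Thm. 9.1 for Thm. 4.2 — brick M3: the span of the symmetrised Young tensors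

Topic `Literature/Computability/AlgebraicComplexity` (val-lit cell, programme "IK20 #4" = discharge
of the cite-fact `IK2020_thm_9_1_orbitFunctions`, route `HOME/bip/NOTE-t02g6-G-discharge-sizing.md`,
brick M3; lead-bip ruling #12a). Theorems only: no definition, no named fact, no instance.

Setting: the Weyl module `{λ} = c_λ · (k^m)^{⊗n}` of the tree (`weylModule`, `c_λ = a_λ b_λ` the
Young symmetrizer of the canonical tableau acting by `permTensorRep`), the basis tensors `e_x`
(`tensorBasis … x`, `x : Fin n → Fin m` a word = a filling of `λ`), the permutation matrices
`P_π = IK2020.permGL k π ∈ GL_m` acting by `glTensorRep`. For a word `x` put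
`h_x := ∑_{π ∈ 𝔖_m} P_π · (c_λ e_x)` — the **𝔖_m-symmetrised Young tensor**; by brick M1 (t08) the
orbit function `f^{S_x}(g) = ∑_π γ(g, π S_x)` of IK 2020 §13 is the `e_{w₀}`-coordinate of `g · h_x`
(up to `|R_λ|`). This file proves the dimension statement that IK obtain from Thm. 9.1 + Prop. 10.1
(TeX L735–750, L850–853: "`𝒲_ϱ ≅ (𝒲'_ϱ)^{𝔖_m}`", "`dim ({λ}_ϱ)^{𝔖_m} = b(λ,ϱ,D,d)`"), directly in
`(k^m)^{⊗n}`: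

* `IK2020.glTensorRep_permGL_tensorBasis` (`P_π e_x = e_{π∘x}`), `IK2020.tensorBasis_mem_weightSpace`
  (`e_x` has weight `content(x)`), `IK2020.young_apply_of_mem_weylModule` (`c_λ v = n_λ v` on `{λ}`),
  `IK2020.young_tensorBasis_eq_zero_of_not_isColStrict` (`c_λ e_x = 0` if `x` repeats a letter in a
  column), `IK2020.symYoung_comp_perm` (`h_{π∘x} = h_x`), `IK2020.symYoung_mem_weylModule`;
* **`IK2020.span_symYoung_eq_map_permFixed_contentSubspace`** — for a partition `ϱ`:
  `span {h_x | content(x) ∈ 𝔖_m · (D·ϱ)} = ({λ}_ϱ)^{𝔖_m}` (the tree's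
  `permFixed k λ univ (contentSubspace k m D λ ϱ)`, pushed into `(k^m)^{⊗n}`);
* **`IK2020.finrank_span_symYoung_eq_bCoeff`** — hence, over `ℂ` and for IK's data
  (`3 ≤ D ≤ m`, `λ ⊢ dD`, `ϱ ⊢_m d`), `dim span {h_x | …} = b(λ,ϱ,D,d)` by `IK2020_prop_10_1_holds`;
* `IK2020.span_symYoung_le_iSup_weightSpace` — the span lies in the sum of the weight spaces of
  the class `𝔖_m · (D·ϱ)`; `IK2020.iSupIndep_weightSpace` (weight spaces are independent),
  `IK2020.partition_eq_of_class_weight_eq` (distinct partitions give disjoint classes),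
  `IK2020.disjoint_classWeightSpace_biSup` — the class of `ϱ` is disjoint from the sum of any
  finite set of other classes: the `Disjoint` hypothesis of `linearIndependent_iUnion_finite` for M4.

Consumer: brick M4 `IK2020_thm_9_1_orbitFunctions_holds` (unit t13). Honest framing: bookkeeping
of IK's toy model `p = x₁^D + ⋯ + x_m^D`; VP ≠ VNP is NOT proved and nothing here is progress on it.

## References
* [IkenmeyerKandasamy2019] C. Ikenmeyer, U. Kandasamy, arXiv:1911.03990, Thm. 9.1 (TeX L735–750),
  Prop. 10.1 (L850–853), proof of Thm. 4.2 (L1146–1154).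
* [FultonHarrisGTM129] W. Fulton, J. Harris, *Representation Theory*, Lemma 4.26, Thm. 6.3, §15.3.
-/

noncomputable section

open scoped BigOperators

namespace Literature.Computability.AlgebraicComplexity

open _root_.Literature.NumberTheory.DiophantineGeometry

namespace IK2020

section General

variable {k : Type*} [Field k] {m n : ℕ}

/-- **Permutation matrices relabel basis tensors**: `P_π · e_x = e_{π ∘ x}` (IK §7, TeX L650–654:
"We embed `𝔖_m ⊆ G` via permutation matrices … `πT` the tableau with entries relabelled").
[cite: IkenmeyerKandasamy2019, §7] -/
theorem glTensorRep_permGL_tensorBasis (π : Equiv.Perm (Fin m)) (x : Fin n → Fin m) :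
    glTensorRep (Fin m) k n (permGL k π) (tensorBasis k (Fin m) n x) =
      tensorBasis k (Fin m) n (π ∘ x) := by
  classical
  apply (tensorBasis k (Fin m) n).repr.injective
  ext I
  rw [repr_glTensorRep_tensorBasis, Module.Basis.repr_self, Finsupp.single_apply, coe_permGL]
  have hentry : ∀ j, ((π⁻¹).permMatrix k : Matrix (Fin m) (Fin m) k) (I j) (x j) =
      if π (x j) = I j then 1 else 0 := by
    intro j
    simp only [Equiv.Perm.permMatrix, PEquiv.toMatrix_apply, Equiv.toPEquiv_apply,
      Option.mem_some_iff, Equiv.Perm.inv_def, Equiv.symm_apply_eq]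
    by_cases h : π (x j) = I j
    · simp [h]
    · simp [h, Ne.symm h]
  simp_rw [hentry]
  rw [Fintype.prod_boole]
  have hiff : (∀ i, π (x i) = I i) ↔ π ∘ x = I := ⟨fun h => funext h, fun h i => congrFun h i⟩
  simp only [hiff]

/-- The content of a relabelled word: `content(π ∘ x)_i = content(x)_{π⁻¹ i}`.
[cite: IkenmeyerKandasamy2019, §7] -/
theorem wordContent_perm_comp (π : Equiv.Perm (Fin m)) (x : Fin n → Fin m) (i : Fin m) :
    wordContent (π ∘ x) i = wordContent x (π.symm i) := by
  unfold wordContent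
  congr 1
  ext p
  simp only [Finset.mem_filter, Finset.mem_univ, true_and, Function.comp_apply]
  exact π.apply_eq_iff_eq_symm_apply

/-- **Basis tensors are weight vectors**: `e_x` has weight `content(x)` for the diagonal torus
(a diagonal `t` acts on `e_x` by `∏_j t_{x_j x_j} = ∏_i t_{ii}^{content(x)_i}`).
Fulton–Harris §15.3 / Fulton, *Young Tableaux*, §8.2. [cite: FultonHarrisGTM129, §15.3] -/
theorem tensorBasis_mem_weightSpace (x : Fin n → Fin m) :
    tensorBasis k (Fin m) n x ∈
      weightSpace (glTensorRep (Fin m) k n) (fun i => (wordContent x i : ℤ)) := by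
  classical
  intro t ht
  have hdiag := (isDiagonalGL_iff_isDiag t).mp ht
  apply (tensorBasis k (Fin m) n).repr.injective
  ext I
  rw [repr_glTensorRep_tensorBasis, map_smul, Module.Basis.repr_self, Finsupp.smul_apply,
    Finsupp.single_apply, smul_eq_mul]
  by_cases hI : x = I
  · subst hI
    rw [if_pos rfl, mul_one, weightChar]
    have hprod := prod_eq_prod_pow_wordContent (fun i => (t : Matrix (Fin m) (Fin m) k) i i) x
    rw [hprod]
    refine Finset.prod_congr rfl fun i _ => ?_
    rw [zpow_natCast]
  · rw [if_neg hI, mul_zero]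
    obtain ⟨j, hj⟩ := Function.ne_iff.mp (Ne.symm hI)
    exact Finset.prod_eq_zero (Finset.mem_univ j) (hdiag hj)

/-- A weight vector of `(k^m)^{⊗n}` is supported on the basis tensors of its weight (characteristic
zero; the tree's `eq_wordContent_of_weightVector`). [cite: FultonHarrisGTM129, §15.3] -/
theorem repr_eq_zero_of_mem_weightSpace_of_ne [CharZero k] {χ : Weight (Fin m)}
    {v : TensorPower k n (Fin m → k)} (hv : v ∈ weightSpace (glTensorRep (Fin m) k n) χ)
    {x : Fin n → Fin m} (hx : (fun i => (wordContent x i : ℤ)) ≠ χ) :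
    (tensorBasis k (Fin m) n).repr v x = 0 := by
  by_contra hne
  apply hx
  funext i
  exact (eq_wordContent_of_weightVector χ v (fun t ht => hv t ht) hne i).symm

/-- The Young symmetrizer (acting through the positions) commutes with `GL_m` (acting diagonally);
pointwise form of `asAlgebraHom_permTensorRep_comp_glTensorRep`. Fulton–Harris Lemma 6.22.
[cite: FultonHarrisGTM129, Lemma 6.22] -/
theorem glTensorRep_young (lam : Nat.Partition n) (g : GL (Fin m) k)
    (v : TensorPower k n (Fin m → k)) :
    glTensorRep (Fin m) k n g ((permTensorRep k (Fin m → k) n).asAlgebraHom (youngSymmetrizer k lam) v) =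
      (permTensorRep k (Fin m → k) n).asAlgebraHom (youngSymmetrizer k lam)
        (glTensorRep (Fin m) k n g v) := by
  have h := asAlgebraHom_permTensorRep_comp_glTensorRep (σ := Fin m) (k := k) (d := n)
    (youngSymmetrizer k lam) g
  exact (LinearMap.congr_fun h v).symm

/-- The Young symmetrizer preserves weight spaces of `(k^m)^{⊗n}` (it commutes with the torus).
[cite: FultonHarrisGTM129, Lemma 6.22] -/
theorem young_mem_weightSpace (lam : Nat.Partition n) {χ : Weight (Fin m)}
    {v : TensorPower k n (Fin m → k)} (hv : v ∈ weightSpace (glTensorRep (Fin m) k n) χ) :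
    (permTensorRep k (Fin m → k) n).asAlgebraHom (youngSymmetrizer k lam) v ∈
      weightSpace (glTensorRep (Fin m) k n) χ := by
  intro t ht
  rw [glTensorRep_young, hv t ht, map_smul]

/-- `c_λ² = n_λ c_λ` applied to a tensor (`youngSymmetrizer_sq`, Fulton–Harris Lemma 4.26).
[cite: FultonHarrisGTM129, Lemma 4.26] -/
theorem young_young_apply [CharZero k] (lam : Nat.Partition n) (v : TensorPower k n (Fin m → k)) :
    (permTensorRep k (Fin m → k) n).asAlgebraHom (youngSymmetrizer k lam)
        ((permTensorRep k (Fin m → k) n).asAlgebraHom (youngSymmetrizer k lam) v) =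
      (youngSymmetrizer k lam * youngSymmetrizer k lam).coeff 1 •
        (permTensorRep k (Fin m → k) n).asAlgebraHom (youngSymmetrizer k lam) v := by
  have hsq := youngSymmetrizer_sq k lam
  set nl := (youngSymmetrizer k lam * youngSymmetrizer k lam).coeff 1 with hnl
  rw [← Module.End.mul_apply, ← map_mul, hsq, map_smul, LinearMap.smul_apply]

/-- On the Weyl module `{λ} = c_λ · (k^m)^{⊗n}` the Young symmetrizer acts as the nonzero scalar
`n_λ` (Fulton–Harris Lemma 4.26). [cite: FultonHarrisGTM129, Lemma 4.26] -/
theorem young_apply_of_mem_weylModule [CharZero k] (lam : Nat.Partition n)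
    {v : TensorPower k n (Fin m → k)} (hv : v ∈ weylModule k (Fin m) lam) :
    (permTensorRep k (Fin m → k) n).asAlgebraHom (youngSymmetrizer k lam) v =
      (youngSymmetrizer k lam * youngSymmetrizer k lam).coeff 1 • v := by
  obtain ⟨w, rfl⟩ := hv
  exact young_young_apply lam w

/-- `c_λ e_x = 0` when the filling `x` repeats a letter inside a column of the canonical tableau
(`c_λ = a_λ b_λ` and `b_λ e_x = 0`, `colAntisymmetrizer_tensorBasis_eq_zero`; IK Cor. 8.5: "if `T`
is not regular then `γ(gT) = 0`"). [cite: IkenmeyerKandasamy2019, Cor. 8.5] -/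
theorem young_tensorBasis_eq_zero_of_not_isColStrict [CharZero k] (lam : Nat.Partition n)
    {x : Fin n → Fin m} (hx : ¬ IsColStrict lam x) :
    (permTensorRep k (Fin m → k) n).asAlgebraHom (youngSymmetrizer k lam)
      (tensorBasis k (Fin m) n x) = 0 := by
  rw [youngSymmetrizer, map_mul, Module.End.mul_apply, colAntisymmetrizer_tensorBasis_eq_zero lam hx,
    map_zero]

/-- The symmetrised Young tensor of a relabelled word: `h_{π₀ ∘ x} = h_x` (re-indexing the sum
over `𝔖_m`; `c_λ e_{π₀∘x} = P_{π₀} c_λ e_x`). [cite: IkenmeyerKandasamy2019, §13 (proof of Thm. 4.2)] -/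
theorem symYoung_comp_perm (lam : Nat.Partition n) (π₀ : Equiv.Perm (Fin m)) (x : Fin n → Fin m) :
    (∑ π : Equiv.Perm (Fin m), glTensorRep (Fin m) k n (permGL k π)
        ((permTensorRep k (Fin m → k) n).asAlgebraHom (youngSymmetrizer k lam)
          (tensorBasis k (Fin m) n (π₀ ∘ x)))) =
      ∑ π : Equiv.Perm (Fin m), glTensorRep (Fin m) k n (permGL k π)
        ((permTensorRep k (Fin m → k) n).asAlgebraHom (youngSymmetrizer k lam)
          (tensorBasis k (Fin m) n x)) := by
  have hterm : ∀ π : Equiv.Perm (Fin m), glTensorRep (Fin m) k n (permGL k π)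
      ((permTensorRep k (Fin m → k) n).asAlgebraHom (youngSymmetrizer k lam)
        (tensorBasis k (Fin m) n (π₀ ∘ x))) =
      glTensorRep (Fin m) k n (permGL k (π * π₀))
        ((permTensorRep k (Fin m → k) n).asAlgebraHom (youngSymmetrizer k lam)
          (tensorBasis k (Fin m) n x)) := by
    intro π
    rw [← glTensorRep_permGL_tensorBasis π₀ x, ← glTensorRep_young lam (permGL k π₀),
      ← Module.End.mul_apply, ← map_mul, permGL_mul]
  simp_rw [hterm]
  exact Fintype.sum_equiv (Equiv.mulRight π₀) _ _ fun π => rfl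

/-- The symmetrised Young tensor `h_x` lies in the Weyl module `{λ}`.
[cite: IkenmeyerKandasamy2019, §9 (Thm. 9.1)] -/
theorem symYoung_mem_weylModule (lam : Nat.Partition n) (x : Fin n → Fin m) :
    (∑ π : Equiv.Perm (Fin m), glTensorRep (Fin m) k n (permGL k π)
        ((permTensorRep k (Fin m → k) n).asAlgebraHom (youngSymmetrizer k lam)
          (tensorBasis k (Fin m) n x))) ∈ weylModule k (Fin m) lam := by
  refine Submodule.sum_mem _ fun π _ => ?_
  rw [glTensorRep_young]
  exact ⟨_, rfl⟩

/-- Weight spaces of the Weyl representation are cut out from those of `(k^m)^{⊗n}` (the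
sub-representation acts by restriction). [cite: FultonHarrisGTM129, §15.3] -/
theorem mem_weightSpace_weylRep_iff' (lam : Nat.Partition n) (χ : Weight (Fin m))
    (v : weylModule k (Fin m) lam) :
    v ∈ weightSpace (V := weylModule k (Fin m) lam) (weylRep k (Fin m) lam) χ ↔
      (v : TensorPower k n (Fin m → k)) ∈ weightSpace (glTensorRep (Fin m) k n) χ := by
  rw [mem_weightSpace_iff, mem_weightSpace_iff]
  refine forall₂_congr fun t _ => ?_
  rw [Subtype.ext_iff, coe_weylRep_apply, Submodule.coe_smul]

end General

/-! ## The span of the symmetrised Young tensors of one content class -/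

section Span

variable {k : Type*} [Field k] [CharZero k] {m n d : ℕ}

omit [CharZero k] in
/-- **The span of the symmetrised Young tensors is contained in the sum of the weight spaces of
the class** `𝔖_m · (D·ϱ)` of `(k^m)^{⊗n}` (each `P_π c_λ e_x = c_λ e_{π∘x}` is a weight vector of
weight `content(π ∘ x)`). [cite: IkenmeyerKandasamy2019, Thm. 9.1 (direct sum over `ϱ`)] -/
theorem span_symYoung_le_iSup_weightSpace (lam : Nat.Partition n) (D : ℕ) (ϱ : Nat.Partition d) :
    Submodule.span k
        ((fun x : Fin n → Fin m => ∑ π : Equiv.Perm (Fin m), glTensorRep (Fin m) k n (permGL k π)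
            ((permTensorRep k (Fin m → k) n).asAlgebraHom (youngSymmetrizer k lam)
              (tensorBasis k (Fin m) n x))) ''
          {x | ∃ π : Equiv.Perm (Fin m), (fun i => (wordContent x i : ℤ)) =
            fun i => (D : ℤ) * Weight.ofPartition m ϱ (π i)}) ≤
      ⨆ π : Equiv.Perm (Fin m), weightSpace (glTensorRep (Fin m) k n)
        (fun i => (D : ℤ) * Weight.ofPartition m ϱ (π i)) := by
  rw [Submodule.span_le]
  rintro _ ⟨x, ⟨π₀, hx⟩, rfl⟩
  refine Submodule.sum_mem _ fun π _ => ?_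
  rw [glTensorRep_young, glTensorRep_permGL_tensorBasis]
  have hw : (permTensorRep k (Fin m → k) n).asAlgebraHom (youngSymmetrizer k lam)
      (tensorBasis k (Fin m) n (π ∘ x)) ∈ weightSpace (glTensorRep (Fin m) k n)
        (fun i => (D : ℤ) * Weight.ofPartition m ϱ ((π₀ * π⁻¹) i)) := by
    have h := young_mem_weightSpace lam (tensorBasis_mem_weightSpace (k := k) (π ∘ x))
    have heq : (fun i => (wordContent (π ∘ x) i : ℤ)) =
        fun i => (D : ℤ) * Weight.ofPartition m ϱ ((π₀ * π⁻¹) i) := by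
      funext i
      rw [wordContent_perm_comp, show (wordContent x (π.symm i) : ℤ) =
        (fun i => (wordContent x i : ℤ)) (π.symm i) from rfl, hx]
      rfl
    rw [heq] at h
    exact h
  exact (le_iSup (fun π' : Equiv.Perm (Fin m) => weightSpace (glTensorRep (Fin m) k n)
    (fun i => (D : ℤ) * Weight.ofPartition m ϱ (π' i))) (π₀ * π⁻¹)) hw

/-- **M3 — the span of the symmetrised Young tensors of a content class is `({λ}_ϱ)^{𝔖_m}`.**
For a partition `ϱ`: `span {h_x | content(x) ∈ 𝔖_m·(D·ϱ)}`, `h_x = ∑_π P_π c_λ e_x`, equals the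
tree's `permFixed k λ univ (contentSubspace k m D λ ϱ)` (the `𝔖_m`-fixed vectors of the sum of the
weight spaces `{λ}^{D·(ϱ∘π)}`) pushed into `(k^m)^{⊗n}`. (`⊆`: each `h_x` is `𝔖_m`-fixed and a sum of
weight vectors `c_λ e_{π∘x} ∈ {λ}`. `⊇`: a weight vector `w ∈ {λ}` satisfies `w = n_λ⁻¹ c_λ w` and is
supported on basis tensors of its weight, so `w ∈ span {c_λ e_x}`; an `𝔖_m`-fixed `v` equals
`|𝔖_m|⁻¹ ∑_σ P_σ v`, and `∑_σ P_σ (c_λ e_x) = h_x`.) This is the dimension-carrying identity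
behind IK's "`𝒲_ϱ` is isomorphic to the `𝔖_m`-invariant subspace of `𝒲'_ϱ`" (Thm. 9.1, TeX
L745–750). [cite: IkenmeyerKandasamy2019, Thm. 9.1] -/
theorem span_symYoung_eq_map_permFixed_contentSubspace (lam : Nat.Partition n) (D : ℕ)
    (ϱ : Nat.Partition d) :
    Submodule.span k
        ((fun x : Fin n → Fin m => ∑ π : Equiv.Perm (Fin m), glTensorRep (Fin m) k n (permGL k π)
            ((permTensorRep k (Fin m → k) n).asAlgebraHom (youngSymmetrizer k lam)
              (tensorBasis k (Fin m) n x))) ''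
          {x | ∃ π : Equiv.Perm (Fin m), (fun i => (wordContent x i : ℤ)) =
            fun i => (D : ℤ) * Weight.ofPartition m ϱ (π i)}) =
      (permFixed k lam Set.univ (contentSubspace k m D lam ϱ)).map
        (weylModule k (Fin m) lam).subtype := by
  classical
  set c := (permTensorRep k (Fin m → k) n).asAlgebraHom (youngSymmetrizer k lam) with hc
  set X : Set (Fin n → Fin m) := {x | ∃ π : Equiv.Perm (Fin m),
    (fun i => (wordContent x i : ℤ)) = fun i => (D : ℤ) * Weight.ofPartition m ϱ (π i)} with hX
  set hx : (Fin n → Fin m) → TensorPower k n (Fin m → k) := fun x =>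
    ∑ π : Equiv.Perm (Fin m), glTensorRep (Fin m) k n (permGL k π) (c (tensorBasis k (Fin m) n x))
    with hhx
  -- membership in `permFixed univ (contentSubspace)` unfolded
  have mem_pf : ∀ v : weylModule k (Fin m) lam,
      v ∈ permFixed k lam Set.univ (contentSubspace k m D lam ϱ) ↔
        v ∈ contentSubspace k m D lam ϱ ∧
          ∀ σ : Equiv.Perm (Fin m), weylRep k (Fin m) lam (permGL k σ) v = v := by
    intro v
    simp only [permFixed, Submodule.mem_inf, Submodule.mem_iInf, Set.mem_univ, LinearMap.mem_eqLocus,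
      LinearMap.id_coe, id_eq, forall_true_left]
  apply le_antisymm
  · -- `⊆`
    rw [Submodule.span_le]
    rintro _ ⟨x, ⟨π₀, hxc⟩, rfl⟩
    have hmem : hx x ∈ weylModule k (Fin m) lam := symYoung_mem_weylModule lam x
    refine ⟨⟨hx x, hmem⟩, ?_, rfl⟩
    rw [SetLike.mem_coe, mem_pf]
    constructor
    · -- in the content subspace: each summand is a weight vector of a weight of the class
      have hsum : (⟨hx x, hmem⟩ : weylModule k (Fin m) lam) =
          ∑ π : Equiv.Perm (Fin m), ⟨glTensorRep (Fin m) k n (permGL k π) (c (tensorBasis k (Fin m) n x)),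
            by rw [glTensorRep_young]; exact ⟨_, rfl⟩⟩ := by
        apply Subtype.ext
        rw [Submodule.coe_sum]
      rw [hsum]
      refine Submodule.sum_mem _ fun π _ => ?_
      have hw : (⟨glTensorRep (Fin m) k n (permGL k π) (c (tensorBasis k (Fin m) n x)), by
            rw [glTensorRep_young]; exact ⟨_, rfl⟩⟩ : weylModule k (Fin m) lam) ∈
          weightSpace (V := weylModule k (Fin m) lam) (weylRep k (Fin m) lam)
            (fun i => (D : ℤ) * Weight.ofPartition m ϱ ((π₀ * π⁻¹) i)) := by
        rw [mem_weightSpace_weylRep_iff', Submodule.coe_mk, glTensorRep_young,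
          glTensorRep_permGL_tensorBasis]
        have h := young_mem_weightSpace lam (tensorBasis_mem_weightSpace (k := k) (π ∘ x))
        have heq : (fun i => (wordContent (π ∘ x) i : ℤ)) =
            fun i => (D : ℤ) * Weight.ofPartition m ϱ ((π₀ * π⁻¹) i) := by
          funext i
          rw [wordContent_perm_comp, show (wordContent x (π.symm i) : ℤ) =
            (fun i => (wordContent x i : ℤ)) (π.symm i) from rfl, hxc]
          rfl
        rw [heq] at h
        exact h
      exact (le_iSup (fun π' : Equiv.Perm (Fin m) => weightSpace (V := weylModule k (Fin m) lam)
        (weylRep k (Fin m) lam) (fun i => (D : ℤ) * Weight.ofPartition m ϱ (π' i))) (π₀ * π⁻¹)) hw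
    · -- fixed by every permutation matrix
      intro σ
      apply Subtype.ext
      rw [coe_weylRep_apply, Submodule.coe_mk]
      change glTensorRep (Fin m) k n (permGL k σ) (∑ π : Equiv.Perm (Fin m),
        glTensorRep (Fin m) k n (permGL k π) (c (tensorBasis k (Fin m) n x))) =
        ∑ π : Equiv.Perm (Fin m), glTensorRep (Fin m) k n (permGL k π) (c (tensorBasis k (Fin m) n x))
      rw [map_sum]
      have hterm : ∀ π : Equiv.Perm (Fin m), glTensorRep (Fin m) k n (permGL k σ)
          (glTensorRep (Fin m) k n (permGL k π) (c (tensorBasis k (Fin m) n x))) =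
          glTensorRep (Fin m) k n (permGL k (σ * π)) (c (tensorBasis k (Fin m) n x)) := fun π => by
        rw [← Module.End.mul_apply, ← map_mul, permGL_mul]
      simp_rw [hterm]
      exact Fintype.sum_equiv (Equiv.mulLeft σ) _ _ fun π => rfl
  · -- `⊇`
    rintro _ ⟨v, hv, rfl⟩
    rw [SetLike.mem_coe, mem_pf] at hv
    obtain ⟨hvc, hvfix⟩ := hv
    -- the span `T` of the Young tensors `c e_x`, `x ∈ X`, contains every weight vector of `{λ}` of
    -- a weight of the class, hence (the content subspace being their sum) contains `v`
    set T : Submodule k (TensorPower k n (Fin m → k)) :=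
      Submodule.span k ((fun x => c (tensorBasis k (Fin m) n x)) '' X) with hT
    have hT_weight : ∀ (π : Equiv.Perm (Fin m)) (w : weylModule k (Fin m) lam),
        w ∈ weightSpace (V := weylModule k (Fin m) lam) (weylRep k (Fin m) lam)
          (fun i => (D : ℤ) * Weight.ofPartition m ϱ (π i)) →
        (w : TensorPower k n (Fin m → k)) ∈ T := by
      intro π w hw
      rw [mem_weightSpace_weylRep_iff'] at hw
      have hn : (youngSymmetrizer k lam * youngSymmetrizer k lam).coeff 1 ≠ 0 :=
        coeff_sq_youngSymmetrizer_ne_zero k lam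
      have hcw : c (w : TensorPower k n (Fin m → k)) =
          (youngSymmetrizer k lam * youngSymmetrizer k lam).coeff 1 • (w : TensorPower k n (Fin m → k)) :=
        young_apply_of_mem_weylModule lam w.2
      have hw' : (w : TensorPower k n (Fin m → k)) =
          ((youngSymmetrizer k lam * youngSymmetrizer k lam).coeff 1)⁻¹ •
            c (w : TensorPower k n (Fin m → k)) := by
        rw [hcw, smul_smul, inv_mul_cancel₀ hn, one_smul]
      rw [hw']
      refine Submodule.smul_mem _ _ ?_
      -- expand `w` in the basis: only words of the right content occur
      have hexp : c (w : TensorPower k n (Fin m → k)) =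
          ∑ y : Fin n → Fin m, (tensorBasis k (Fin m) n).repr (w : TensorPower k n (Fin m → k)) y •
            c (tensorBasis k (Fin m) n y) := by
        conv_lhs => rw [← (tensorBasis k (Fin m) n).sum_repr (w : TensorPower k n (Fin m → k))]
        rw [map_sum]
        simp_rw [map_smul]
      rw [hexp]
      refine Submodule.sum_mem _ fun y _ => ?_
      by_cases hy : (fun i => (wordContent y i : ℤ)) = fun i => (D : ℤ) * Weight.ofPartition m ϱ (π i)
      · exact Submodule.smul_mem _ _ (Submodule.subset_span ⟨y, ⟨π, hy⟩, rfl⟩)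
      · rw [repr_eq_zero_of_mem_weightSpace_of_ne hw hy, zero_smul]
        exact Submodule.zero_mem _
    have hvT : (v : TensorPower k n (Fin m → k)) ∈ T := by
      have hle : contentSubspace k m D lam ϱ ≤ T.comap (weylModule k (Fin m) lam).subtype :=
        iSup_le fun π w hw => hT_weight π w hw
      exact hle hvc
    -- averaging over `𝔖_m`
    set Avg : TensorPower k n (Fin m → k) →ₗ[k] TensorPower k n (Fin m → k) :=
      ∑ σ : Equiv.Perm (Fin m), glTensorRep (Fin m) k n (permGL k σ) with hAvg
    have hAvg_v : Avg (v : TensorPower k n (Fin m → k)) =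
        (Fintype.card (Equiv.Perm (Fin m)) : k) • (v : TensorPower k n (Fin m → k)) := by
      rw [hAvg, LinearMap.sum_apply]
      have : ∀ σ : Equiv.Perm (Fin m),
          glTensorRep (Fin m) k n (permGL k σ) (v : TensorPower k n (Fin m → k)) = v := fun σ => by
        have := congrArg Subtype.val (hvfix σ)
        rwa [coe_weylRep_apply] at this
      simp_rw [this]
      rw [Finset.sum_const, Finset.card_univ, Nat.cast_smul_eq_nsmul]
    have hcard : (Fintype.card (Equiv.Perm (Fin m)) : k) ≠ 0 :=
      Nat.cast_ne_zero.mpr Fintype.card_ne_zero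
    have hv_eq : (v : TensorPower k n (Fin m → k)) =
        (Fintype.card (Equiv.Perm (Fin m)) : k)⁻¹ • Avg (v : TensorPower k n (Fin m → k)) := by
      rw [hAvg_v, smul_smul, inv_mul_cancel₀ hcard, one_smul]
    -- `Avg` maps `T` into the span of the `h_x`
    have hAvgT : T.map Avg ≤ Submodule.span k (hx '' X) := by
      rw [hT, Submodule.map_span, Submodule.span_le]
      rintro _ ⟨_, ⟨x, hxX, rfl⟩, rfl⟩
      refine Submodule.subset_span ⟨x, hxX, ?_⟩
      rw [hhx, hAvg, LinearMap.sum_apply]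
    rw [Submodule.coe_subtype, hv_eq]
    exact Submodule.smul_mem _ _ (hAvgT ⟨_, hvT, rfl⟩)

/-- **M3, dimension form — `dim span {h_x | content(x) ∈ 𝔖_m·(D·ϱ)} = b(λ,ϱ,D,d)`** for IK's
data (`3 ≤ D ≤ m`, `λ ⊢ dD` with at most `m` parts, `ϱ ⊢_m d`), from
`span_symYoung_eq_map_permFixed_contentSubspace` and Prop. 10.1 (`IK2020_prop_10_1_holds`,
"`dim ({λ}_ϱ)^{𝔖_m} = b(λ,ϱ,D,d)`", TeX L850–853). This is the count that Thm. 9.1 + Prop. 10.1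
supply to the proof of Thm. 4.2 (TeX L1147–1150). [cite: IkenmeyerKandasamy2019, Thm. 9.1 and Prop. 10.1] -/
theorem finrank_span_symYoung_eq_bCoeff {m D d : ℕ} (hD : 3 ≤ D) (hDm : D ≤ m)
    (lam : Nat.Partition (d * D)) (hlam : lam.parts.card ≤ m) (ϱ : Nat.Partition d)
    (hϱ : ϱ.parts.card ≤ m) :
    Module.finrank ℂ (Submodule.span ℂ
        ((fun x : Fin (d * D) → Fin m => ∑ π : Equiv.Perm (Fin m),
            glTensorRep (Fin m) ℂ (d * D) (permGL ℂ π)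
              ((permTensorRep ℂ (Fin m → ℂ) (d * D)).asAlgebraHom (youngSymmetrizer ℂ lam)
                (tensorBasis ℂ (Fin m) (d * D) x))) ''
          {x | ∃ π : Equiv.Perm (Fin m), (fun i => (wordContent x i : ℤ)) =
            fun i => (D : ℤ) * Weight.ofPartition m ϱ (π i)})) =
      bCoeff ℂ m D d lam ϱ := by
  rw [span_symYoung_eq_map_permFixed_contentSubspace,
    ← (Submodule.equivMapOfInjective _ (Submodule.injective_subtype _) _).finrank_eq]
  exact IK2020_prop_10_1_holds m D d hD hDm lam hlam ϱ hϱ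

end Span

/-! ## Separation of distinct content classes -/

section Classes

variable {k : Type*} [Field k] {m : ℕ}

/-- **Weight spaces of distinct weights are independent** (`iSupIndep`): the `Submodule`-lattice
form of the tree's `eq_zero_of_sum_weightVectors_eq_zero` (torus characters are linearly
independent). Fulton–Harris §15.3. [cite: FultonHarrisGTM129, §15.3] -/
theorem iSupIndep_weightSpace [Infinite k] {V : Type*} [AddCommGroup V] [Module k V]
    (ρ : Representation k (GL (Fin m) k) V) :
    iSupIndep fun γ : Weight (Fin m) => weightSpace ρ γ := by
  classical
  rw [iSupIndep_def]
  intro γ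
  rw [Submodule.disjoint_def]
  intro v hv hv'
  -- a finite decomposition of `v` along the other weight spaces
  have hv'' : v ∈ ⨆ δ : {δ : Weight (Fin m) // δ ≠ γ}, weightSpace ρ δ.val := by
    rw [iSup_subtype'] at hv'; exact hv'
  obtain ⟨s, hs⟩ := Submodule.mem_iSup_iff_exists_finset.mp hv''
  obtain ⟨μ, hμ⟩ := (Submodule.mem_iSup_finset_iff_exists_sum _ _).mp hs
  -- the family of weight vectors `-v` (weight `γ`) and `μ δ` (weights `δ ≠ γ`) sums to zero
  let O : Finset (Weight (Fin m)) := insert γ (s.image Subtype.val)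
  let w : Weight (Fin m) → V := fun δ =>
    if δ = γ then -v else ∑ i ∈ s, if i.val = δ then (μ i : V) else 0
  have hwmem : ∀ δ ∈ O, w δ ∈ weightSpace ρ δ := by
    intro δ _
    by_cases hδ : δ = γ
    · subst hδ; simp only [w, if_true]; exact Submodule.neg_mem _ hv
    · simp only [w, if_neg hδ]
      refine Submodule.sum_mem _ fun i _ => ?_
      split_ifs with hi
      · rw [← hi]; exact (μ i).2
      · exact Submodule.zero_mem _
  have hγ : γ ∉ s.image Subtype.val := by
    intro hmem
    obtain ⟨δ, -, hδ⟩ := Finset.mem_image.mp hmem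
    exact δ.2 hδ
  have hsum : ∑ δ ∈ O, w δ = 0 := by
    rw [Finset.sum_insert hγ]
    have h1 : w γ = -v := by simp [w]
    have h2 : ∑ δ ∈ s.image Subtype.val, w δ = ∑ i ∈ s, (μ i : V) := by
      rw [Finset.sum_image (fun i _ j _ h => Subtype.ext h)]
      refine Finset.sum_congr rfl fun i hi => ?_
      have hne : i.val ≠ γ := i.2
      simp only [w, if_neg hne]
      rw [Finset.sum_eq_single i]
      · rw [if_pos rfl]
      · intro j _ hji
        rw [if_neg (fun h => hji (Subtype.ext h))]
      · exact fun h => absurd hi h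
    rw [h1, h2, hμ, neg_add_cancel]
  have h0 := eq_zero_of_sum_weightVectors_eq_zero ρ O w hwmem hsum γ (Finset.mem_insert_self _ _)
  simp only [w, if_true, neg_eq_zero] at h0
  exact h0

/-- **Distinct content classes are distinct sets of weights**: if `D ≠ 0` and the padded parts
vectors of `ϱ, ϱ' ⊢ d` (at most `m` parts) agree up to a permutation after scaling by `D`, then
`ϱ = ϱ'` (IK Thm. 9.1: the decomposition `⊕_{ϱ ⊢_m d} 𝒲_ϱ` is indexed by partitions).
[cite: IkenmeyerKandasamy2019, Thm. 9.1] -/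
theorem partition_eq_of_class_weight_eq {d D : ℕ} (hD : D ≠ 0) {ϱ ϱ' : Nat.Partition d}
    (hϱ : ϱ.parts.card ≤ m) (hϱ' : ϱ'.parts.card ≤ m) {π π' : Equiv.Perm (Fin m)}
    (h : (fun i => (D : ℤ) * Weight.ofPartition m ϱ (π i)) =
      fun i => (D : ℤ) * Weight.ofPartition m ϱ' (π' i)) : ϱ = ϱ' := by
  -- the padded parts multiset of a partition is `parts + zeros`
  have hpad : ∀ (ρ : Nat.Partition d), ρ.parts.card ≤ m →
      (Finset.univ.val.map fun a : Fin m => ρ.sortedParts.getD a 0) =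
        ρ.parts + Multiset.replicate (m - ρ.parts.card) 0 := by
    intro ρ hρ
    have hlen : ρ.sortedParts.length ≤ m := by rw [Nat.Partition.length_sortedParts]; exact hρ
    have hl : (List.ofFn fun a : Fin m => ρ.sortedParts.getD a 0) =
        ρ.sortedParts ++ List.replicate (m - ρ.sortedParts.length) 0 := by
      apply List.ext_getElem
      · rw [List.length_ofFn, List.length_append, List.length_replicate]; omega
      · intro i h1 h2
        rw [List.getElem_ofFn]
        by_cases hi : i < ρ.sortedParts.length
        · rw [List.getElem_append_left hi, List.getD_eq_getElem _ _ hi]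
        · rw [List.getElem_append_right (not_lt.mp hi), List.getElem_replicate,
            List.getD_eq_default _ _ (not_lt.mp hi)]
    have hcoe : (ρ.sortedParts : Multiset ℕ) = ρ.parts := Multiset.sort_eq _ _
    rw [Fin.univ_val_map, hl, ← Multiset.coe_add, Multiset.coe_replicate, hcoe,
      Nat.Partition.length_sortedParts]
  -- the values agree pointwise after un-scaling, hence as multisets after un-permuting
  have hpt : ∀ i, ϱ.sortedParts.getD (π i) 0 = ϱ'.sortedParts.getD (π' i) 0 := by
    intro i
    have hi := congrFun h i
    simp only [Weight.ofPartition_apply] at hi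
    exact_mod_cast mul_left_cancel₀ (Int.natCast_ne_zero.mpr hD) hi
  have hms : (Finset.univ.val.map fun a : Fin m => ϱ.sortedParts.getD a 0) =
      Finset.univ.val.map fun a : Fin m => ϱ'.sortedParts.getD a 0 := by
    have e1 : (Finset.univ.val.map fun a : Fin m => ϱ.sortedParts.getD a 0) =
        Finset.univ.val.map fun i : Fin m => ϱ.sortedParts.getD (π i) 0 := by
      conv_lhs => rw [← Finset.map_univ_equiv π, Finset.map_val, Multiset.map_map]
      rfl
    have e2 : (Finset.univ.val.map fun a : Fin m => ϱ'.sortedParts.getD a 0) =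
        Finset.univ.val.map fun i : Fin m => ϱ'.sortedParts.getD (π' i) 0 := by
      conv_lhs => rw [← Finset.map_univ_equiv π', Finset.map_val, Multiset.map_map]
      rfl
    rw [e1, e2]
    exact Multiset.map_congr rfl fun i _ => hpt i
  rw [hpad ϱ hϱ, hpad ϱ' hϱ'] at hms
  -- remove the zeros: parts are positive
  have hfilter : ∀ (ρ : Nat.Partition d) (r : ℕ),
      (ρ.parts + Multiset.replicate r 0).filter (fun a => a ≠ 0) = ρ.parts := by
    intro ρ r
    rw [Multiset.filter_add, Multiset.filter_eq_self.mpr (fun a ha => (ρ.parts_pos ha).ne'),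
      Multiset.filter_eq_nil.mpr (fun a ha => by rw [Multiset.eq_of_mem_replicate ha]; exact fun h => h rfl),
      add_zero]
  have hparts : ϱ.parts = ϱ'.parts := by
    rw [← hfilter ϱ (m - ϱ.parts.card), ← hfilter ϱ' (m - ϱ'.parts.card), hms]
  exact Nat.Partition.ext hparts

/-- **Distinct content classes live in disjoint parts of `(k^m)^{⊗n}`**: for partitions with at
most `m` parts and `D ≠ 0`, the sum of the weight spaces of the class `𝔖_m·(D·ϱ)` meets the sum
over any set of other classes trivially (independence of weight spaces +
`partition_eq_of_class_weight_eq`). With `span_symYoung_le_iSup_weightSpace` this is the `Disjoint`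
hypothesis of Mathlib's `linearIndependent_iUnion_finite` for families drawn class by class — the
direct-sum clause of IK Thm. 9.1 ("`HWV_{λ*}(ℂ[Gp]_d) = ⊕_{ϱ ⊢_m d} 𝒲_ϱ`").
[cite: IkenmeyerKandasamy2019, Thm. 9.1] -/
theorem disjoint_classWeightSpace_biSup [Infinite k] {n d D : ℕ} (hD : D ≠ 0)
    {ϱ : Nat.Partition d} (hϱ : ϱ.parts.card ≤ m) {t : Set (Nat.Partition d)}
    (hϱt : ϱ ∉ t) (htm : ∀ ϱ' ∈ t, ϱ'.parts.card ≤ m) :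
    Disjoint
      (⨆ π : Equiv.Perm (Fin m), weightSpace (glTensorRep (Fin m) k n)
        (fun i => (D : ℤ) * Weight.ofPartition m ϱ (π i)))
      (⨆ ϱ' ∈ t, ⨆ π : Equiv.Perm (Fin m), weightSpace (glTensorRep (Fin m) k n)
        (fun i => (D : ℤ) * Weight.ofPartition m ϱ' (π i))) := by
  classical
  set W : Weight (Fin m) → Submodule k (TensorPower k n (Fin m → k)) :=
    fun γ => weightSpace (glTensorRep (Fin m) k n) γ with hW
  set cl : Nat.Partition d → Set (Weight (Fin m)) := fun ρ =>
    Set.range fun π : Equiv.Perm (Fin m) => fun i => (D : ℤ) * Weight.ofPartition m ρ (π i) with hcl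
  have hclass : ∀ ρ : Nat.Partition d,
      (⨆ π : Equiv.Perm (Fin m), W (fun i => (D : ℤ) * Weight.ofPartition m ρ (π i))) =
        ⨆ γ ∈ cl ρ, W γ := fun ρ => by rw [hcl]; exact iSup_range.symm
  have hind := iSupIndep_weightSpace (k := k) (glTensorRep (Fin m) k n)
  -- the class of `ϱ` is finite and disjoint from the union of the classes of `t`
  have hfin : (cl ϱ).Finite := Set.finite_range _
  have hdisj : Disjoint (cl ϱ) (⋃ ϱ' ∈ t, cl ϱ') := by
    rw [Set.disjoint_left]
    rintro γ ⟨π, rfl⟩ hγ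
    simp only [Set.mem_iUnion] at hγ
    obtain ⟨ϱ', hϱ't, π', hπ'⟩ := hγ
    have := partition_eq_of_class_weight_eq (m := m) hD hϱ (htm ϱ' hϱ't) (π := π) (π' := π') hπ'.symm
    exact hϱt (this ▸ hϱ't)
  have key := hind.disjoint_biSup_biSup' hdisj hfin
  rw [← hclass ϱ] at key
  refine key.mono_right ?_
  refine iSup₂_le fun ϱ' hϱ' => ?_
  rw [hclass ϱ']
  exact biSup_mono fun γ hγ => Set.mem_biUnion hϱ' hγ

end Classes

end IK2020

end Literature.Computability.AlgebraicComplexity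

end
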